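import Literature.Probability.RandomPlanarGeometry.SAWTriangularPolygonUnrooting
import Literature.Probability.RandomPlanarGeometry.SAWWidePolygons
import HarnessLib

/-!
# Madras' join on the triangular lattice: merging two capped polygons across the junction rhombus into ONE closing walk

Topic `Literature/Probability/RandomPlanarGeometry` (lane «pcv-sawmu», LINE «TRI-MADRAS», step S4𝕋 (a); continues
`SAWTriangularPolygonUnrooting.lean` (`TriPolygon.loops n`: the closing `n`-step brick walks from `0`),
`SAWWidePolygons.lean`/`SAWPolygonSurgery.lean` (`IsPolygon G E`, `IsPolygon.exists_isPath_erase`: opening a polygon at an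
edge), and the cap rules of `SAWTriangularPolygonJoinCap.lean` (whose outputs carry the two junction edges used here)).

Source.  A. Hammond, arXiv:1504.05286 [Hammond2015SAPJoining], Definition 4.3 p. 20 (arXiv v5): the Madras join polygon
`J(τ,σ) = (τ_mod ∪ (σ_mod + T₂e₁)) Δ P¹`, "The plaquette `P¹` will be called the junction plaquette" — the two modified
polygons, disjoint and one to the left of the other, are merged across a unit square whose two vertical sides they contain.
On `𝕋` (brick frame) the junction is the rhombus `{p, p+(1,1), p+(3,1), p+(2,0)}`: the left polygon contains its side
`p – p+(1,1)`, the right one the parallel side `p+(2,0) – p+(3,1)`, and the join replaces these two sides by the two horizontal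
ones (N. Madras, J. Stat. Phys. 78 (1995) [Madras1995LatticeAnimalsExponent], §2, for `ℤ²`).

## What is proved (namespace `…SAW.TriPolygon`)

**`exists_join_loop`**: for brick polygons `P, Q` (edge sets, `M` edges each) with `p–(p+(1,1)) ∈ P`,
`(p+(2,0))–(p+(3,1)) ∈ Q`, and `P` strictly left of `Q` in every row, there is a closing walk `ρ ∈ loops (2M − 1)` (the
joined `2M`-gon read from `p`, translated to the origin) whose first `M` sites are the vertices of `P − p` (from `0` to
`(1,1)`), whose last `M` sites are the vertices of `Q − p` (from `(3,1)` to `(2,0)`), whose consecutive pairs inside each half are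
edges of `P − p` / `Q − p`, and whose two halves are strictly row-separated — i.e. the four clauses of the decoder's
`IsRowSepCut M (ρ ∘ (· % 2M)) 0` of `SAWTriangularPolygonJoinDecode.lean`, stated here literally (that file is not imported).
-/

noncomputable section

open Finset SimpleGraph Literature.Probability.LatticeModels Literature.Probability.Percolation
open Literature.Probability.Percolation.SiteGadgetSystem (vertsOf mem_vertsOf)

namespace Literature.Probability.RandomPlanarGeometry.SAW

namespace TriPolygon

variable {P Q : Finset (Sym2 (Site 2))} {p : Site 2} {M : ℕ}

/-- `vec` coordinates. [folklore] -/
@[simp] private theorem jvec0 (a b : ℤ) : (![a, b] : Site 2) 0 = a := rfl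
/-- `vec` coordinates. [folklore] -/
@[simp] private theorem jvec1 (a b : ℤ) : (![a, b] : Site 2) 1 = b := rfl

/-- Consecutive vertices of a walk span one of its edges (copy of the tree's `mk_getVert_succ_mem_edges`,
`ZdFiveArmEnvironment.lean`, to keep the imports small). [folklore] -/
private theorem getVert_succ_mem_edges {V : Type*} {G : SimpleGraph V} {a b : V} (U : G.Walk a b) {k : ℕ}
    (hk : k < U.length) : s(U.getVert k, U.getVert (k + 1)) ∈ U.edges := by
  have hlen : k < U.darts.length := by rw [SimpleGraph.Walk.length_darts]; exact hk
  have hd : U.darts[k] ∈ U.darts := List.getElem_mem hlen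
  rw [SimpleGraph.Walk.darts_getElem_eq_getVert k hlen] at hd
  exact List.mem_map.2 ⟨_, hd, rfl⟩

/-- **Merging two row-separated brick polygons across the junction rhombus** (Madras' join, triangular lattice).
See the module docstring. [cite: Hammond2015SAPJoining, Definition 4.3 p. 20 (arXiv v5: the junction plaquette);
Madras1995LatticeAnimalsExponent, §2] -/
theorem exists_join_loop (hP : IsPolygon brickGraph P) (hQ : IsPolygon brickGraph Q)
    (hPM : P.card = M) (hQM : Q.card = M)
    (he₁ : s(p, p + ![1, 1]) ∈ P) (he₂ : s(p + ![2, 0], p + ![3, 1]) ∈ Q)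
    (hsep : ∀ a ∈ vertsOf P, ∀ b ∈ vertsOf Q, a 1 = b 1 → a 0 < b 0) :
    ∃ ρ : ℕ → Site 2, ρ ∈ loops (2 * M - 1) ∧
      ρ 0 = 0 ∧ ρ (M - 1) = ![1, 1] ∧ ρ M = ![3, 1] ∧ ρ (2 * M - 1) = ![2, 0] ∧
      (∀ i, i < M → ρ i + p ∈ vertsOf P) ∧ (∀ i, M ≤ i → i ≤ 2 * M - 1 → ρ i + p ∈ vertsOf Q) ∧
      (∀ x ∈ vertsOf P, ∃ i, i < M ∧ ρ i + p = x) ∧ (∀ x ∈ vertsOf Q, ∃ i, M ≤ i ∧ i ≤ 2 * M - 1 ∧ ρ i + p = x) ∧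
      (∀ i, i + 1 < M → s(ρ i + p, ρ (i + 1) + p) ∈ P) ∧
      (∀ i, M ≤ i → i + 1 ≤ 2 * M - 1 → s(ρ i + p, ρ (i + 1) + p) ∈ Q) ∧
      (∀ a b : ℕ, a < M → M ≤ b → b < 2 * M → ρ a 1 = ρ b 1 → ρ a 0 < ρ b 0) := by
  classical
  -- sizes
  have h3 : 3 ≤ M := by
    obtain ⟨u', c, hc, hcE⟩ := hP
    rw [← hPM, ← hcE, List.toFinset_card_of_nodup hc.edges_nodup, Walk.length_edges]
    exact hc.three_le_length
  -- open `P` at `p – (p+(1,1))` and `Q` at `(p+(3,1)) – (p+(2,0))`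
  obtain ⟨A, hA, hAe, -, hAl, hAs⟩ := hP.exists_isPath_erase he₁
  have he₂' : s(p + ![3, 1], p + ![2, 0]) ∈ Q := by rw [Sym2.eq_swap]; exact he₂
  obtain ⟨B, hB, hBe, -, hBl, hBs⟩ := hQ.exists_isPath_erase he₂'
  have hAlen : A.length = M - 1 := by omega
  have hBlen : B.length = M - 1 := by omega
  -- the junction steps
  have huw : brickGraph.Adj (p + ![1, 1]) (p + ![3, 1]) := by
    rw [brickGraph_adj_iff]; left
    refine ⟨?_, Or.inl ?_⟩
    · show p 1 + 1 = p 1 + 1; rfl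
    · show p 0 + 3 = p 0 + 1 + 2; ring
  have hqp : brickGraph.Adj (p + ![2, 0]) p := by
    rw [brickGraph_adj_iff]; left
    refine ⟨?_, Or.inr ?_⟩
    · show p 1 = p 1 + 0; ring
    · show p 0 + 2 = p 0 + 2; rfl
  -- the closed walk `C = A · (u→w) · B · (q→p)` and its reading `ρ`
  let C : brickGraph.Walk p p := A.append (Walk.cons huw (B.append (Walk.cons hqp Walk.nil)))
  have hClen : C.length = 2 * M := by
    simp only [C, Walk.length_append, Walk.length_cons, Walk.length_nil, hAlen, hBlen]; omega
  have hCA : ∀ i, i ≤ M - 1 → C.getVert i = A.getVert i := by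
    intro i hi
    simp only [C, Walk.getVert_append, hAlen]
    split_ifs with h
    · rfl
    · have hi' : i = M - 1 := by omega
      subst hi'
      rw [Nat.sub_self, Walk.getVert_zero, ← hAlen, Walk.getVert_length]
  have hCB : ∀ i, M ≤ i → i ≤ 2 * M - 1 → C.getVert i = B.getVert (i - M) := by
    intro i hi1 hi2
    simp only [C, Walk.getVert_append, hAlen, if_neg (show ¬ i < M - 1 by omega)]
    rw [Walk.getVert_cons _ _ (by omega), Walk.getVert_append, hBlen]
    split_ifs with h
    · congr 1; omega
    · have hi' : i = 2 * M - 1 := by omega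
      subst hi'
      rw [show 2 * M - 1 - (M - 1) - 1 - (M - 1) = 0 by omega, Walk.getVert_zero,
        show 2 * M - 1 - M = B.length by omega, Walk.getVert_length]
  let ρ : ℕ → Site 2 := fun i => C.getVert (min i (2 * M - 1)) - p
  have hρA : ∀ i, i ≤ M - 1 → ρ i = A.getVert i - p := by
    intro i hi; simp only [ρ, min_eq_left (show i ≤ 2 * M - 1 by omega), hCA i hi]
  have hρB : ∀ i, M ≤ i → i ≤ 2 * M - 1 → ρ i = B.getVert (i - M) - p := by
    intro i hi1 hi2; simp only [ρ, min_eq_left hi2, hCB i hi1 hi2]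
  -- vertices of the two halves
  have hAv : ∀ i, i ≤ M - 1 → A.getVert i ∈ vertsOf P := fun i _ =>
    mem_vertsOf.2 ((hAs _).1 (A.getVert_mem_support i))
  have hBv : ∀ i, B.getVert i ∈ vertsOf Q := fun i =>
    mem_vertsOf.2 ((hBs _).1 (B.getVert_mem_support i))
  -- the row separation of the two halves, in `ρ`-coordinates
  have hsepρ : ∀ a b : ℕ, a < M → M ≤ b → b < 2 * M → ρ a 1 = ρ b 1 → ρ a 0 < ρ b 0 := by
    intro a b ha hb1 hb2 hrow
    rw [hρA a (by omega), hρB b hb1 (by omega)] at hrow ⊢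
    simp only [Pi.sub_apply] at hrow ⊢
    have := hsep _ (hAv a (by omega)) _ (hBv (b - M)) (by omega)
    omega
  refine ⟨ρ, ?_, ?_, ?_, ?_, ?_, ?_, ?_, ?_, ?_, ?_, ?_, hsepρ⟩
  · -- `ρ ∈ loops (2M − 1)`
    rw [mem_loops, mem_brickSaws]
    refine ⟨⟨?_, ?_, ?_, ?_⟩, ?_⟩
    · rw [hρA 0 (by omega), Walk.getVert_zero, sub_self]
    · intro i hi; simp only [ρ, min_eq_right hi, min_self]
    · intro i hi
      have hi' : i < C.length := by rw [hClen]; omega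
      have hadj := C.adj_getVert_succ hi'
      simp only [ρ, min_eq_left (show i ≤ 2 * M - 1 by omega), min_eq_left (show i + 1 ≤ 2 * M - 1 by omega)]
      exact (brickGraph_adj_sub_right _ _ _).2 hadj
    · -- injective on `[0, 2M−1]`: inside each half by the paths, across halves by the separation
      intro i hi j hj hij
      simp only [Set.mem_setOf_eq] at hi hj
      have key : ∀ i j, i ≤ M - 1 → M ≤ j → j ≤ 2 * M - 1 → ρ i ≠ ρ j := by
        intro i j hi hj1 hj2 heq
        have hvP := hAv i hi
        have hvQ := hBv (j - M)
        rw [hρA i hi, hρB j hj1 hj2] at heq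
        have heq' : A.getVert i = B.getVert (j - M) := sub_left_injective heq
        rw [heq'] at hvP
        exact (lt_irrefl _) (hsep _ hvP _ hvQ rfl)
      rcases le_or_gt i (M - 1) with hi1 | hi1 <;> rcases le_or_gt j (M - 1) with hj1 | hj1
      · rw [hρA i hi1, hρA j hj1] at hij
        exact hA.getVert_injOn (by rw [Set.mem_setOf_eq]; omega) (by rw [Set.mem_setOf_eq]; omega)
          (sub_left_injective hij)
      · exact absurd hij (key i j hi1 (by omega) hj)
      · exact absurd hij.symm (key j i hj1 (by omega) hi)
      · rw [hρB i (by omega) hi, hρB j (by omega) hj] at hij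
        have := hB.getVert_injOn (by rw [Set.mem_setOf_eq]; omega) (by rw [Set.mem_setOf_eq]; omega)
          (sub_left_injective hij)
        omega
    · -- closing: `ρ (2M−1) = (2,0)` is adjacent to `0`
      rw [hρB _ (by omega) le_rfl, show 2 * M - 1 - M = M - 1 by omega, ← hBlen, Walk.getVert_length,
        add_sub_cancel_left, brickGraph_adj_iff]
      simp
  · rw [hρA 0 (by omega), Walk.getVert_zero, sub_self]
  · rw [hρA _ le_rfl, ← hAlen, Walk.getVert_length, add_sub_cancel_left]
  · rw [hρB M le_rfl (by omega), Nat.sub_self, Walk.getVert_zero, add_sub_cancel_left]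
  · rw [hρB _ (by omega) le_rfl, show 2 * M - 1 - M = M - 1 by omega, ← hBlen, Walk.getVert_length, add_sub_cancel_left]
  · intro i hi; rw [hρA i (by omega), sub_add_cancel]; exact hAv i (by omega)
  · intro i hi1 hi2; rw [hρB i hi1 hi2, sub_add_cancel]; exact hBv _
  · intro x hx
    obtain ⟨i, hi, rfl⟩ : ∃ i, i ≤ A.length ∧ A.getVert i = x := by
      have := (hAs x).2 (mem_vertsOf.1 hx)
      obtain ⟨i, h1, h2⟩ := Walk.mem_support_iff_exists_getVert.1 this
      exact ⟨i, h2, h1⟩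
    exact ⟨i, by omega, by rw [hρA i (by omega), sub_add_cancel]⟩
  · intro x hx
    obtain ⟨i, hi, rfl⟩ : ∃ i, i ≤ B.length ∧ B.getVert i = x := by
      have := (hBs x).2 (mem_vertsOf.1 hx)
      obtain ⟨i, h1, h2⟩ := Walk.mem_support_iff_exists_getVert.1 this
      exact ⟨i, h2, h1⟩
    exact ⟨i + M, by omega, by omega, by rw [hρB (i + M) (by omega) (by omega), Nat.add_sub_cancel, sub_add_cancel]⟩
  · intro i hi
    rw [hρA i (by omega), hρA (i + 1) (by omega), sub_add_cancel, sub_add_cancel]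
    have hlt : i < A.length := by omega
    have hmem : s(A.getVert i, A.getVert (i + 1)) ∈ A.edges := getVert_succ_mem_edges A hlt
    have := List.mem_toFinset.2 hmem
    rw [hAe] at this
    exact Finset.mem_of_mem_erase this
  · intro i hi1 hi2
    rw [hρB i hi1 (by omega), hρB (i + 1) (by omega) hi2, sub_add_cancel, sub_add_cancel,
      show i + 1 - M = (i - M) + 1 by omega]
    have hlt : i - M < B.length := by omega
    have hmem : s(B.getVert (i - M), B.getVert (i - M + 1)) ∈ B.edges := getVert_succ_mem_edges B hlt
    have := List.mem_toFinset.2 hmem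
    rw [hBe] at this
    exact Finset.mem_of_mem_erase this

/-- **The joined walk has a row-separated equal-split cut at `0`** — literally the four clauses of
`IsRowSepCut M (fun i => ρ (i % (2M))) 0` of `SAWTriangularPolygonJoinDecode.lean` (not imported here), for the `ρ` of
`exists_join_loop`.  [cite: Hammond2015SAPJoining, Definition 4.3 p. 20 (arXiv v5: the junction plaquette of the join polygon)] -/
theorem join_loop_cut {ρ : ℕ → Site 2} (h3 : 3 ≤ M)
    (h0 : ρ 0 = 0) (hu : ρ (M - 1) = ![1, 1]) (hw : ρ M = ![3, 1]) (hq : ρ (2 * M - 1) = ![2, 0])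
    (hsep : ∀ a b : ℕ, a < M → M ≤ b → b < 2 * M → ρ a 1 = ρ b 1 → ρ a 0 < ρ b 0) :
    let v : ℕ → Site 2 := fun i => ρ (i % (2 * M))
    (v (0 + 2 * M - 1) 1 = v 0 1 ∧ v (0 + 2 * M - 1) 0 = v 0 0 + 2) ∧
    (v (0 + M) 1 = v (0 + M - 1) 1 ∧ v (0 + M) 0 = v (0 + M - 1) 0 + 2) ∧
    ((v (0 + M - 1) 1 = v 0 1 + 1 ∨ v (0 + M - 1) 1 + 1 = v 0 1) ∧
      (v (0 + M - 1) 0 = v 0 0 + 1 ∨ v (0 + M - 1) 0 + 1 = v 0 0)) ∧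
    ∀ a b : ℕ, 0 ≤ a → a < 0 + M → 0 + M ≤ b → b < 0 + 2 * M → v a 1 = v b 1 → v a 0 < v b 0 := by
  intro v
  have e1 : v (0 + 2 * M - 1) = ρ (2 * M - 1) := by
    show ρ ((0 + 2 * M - 1) % (2 * M)) = _; rw [Nat.zero_add, Nat.mod_eq_of_lt (by omega)]
  have e2 : v 0 = ρ 0 := by show ρ (0 % (2 * M)) = _; rw [Nat.zero_mod]
  have e3 : v (0 + M) = ρ M := by show ρ ((0 + M) % (2 * M)) = _; rw [Nat.zero_add, Nat.mod_eq_of_lt (by omega)]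
  have e4 : v (0 + M - 1) = ρ (M - 1) := by
    show ρ ((0 + M - 1) % (2 * M)) = _; rw [Nat.zero_add, Nat.mod_eq_of_lt (by omega)]
  have ev : ∀ i, i < 2 * M → v i = ρ i := fun i hi => by show ρ (i % (2 * M)) = _; rw [Nat.mod_eq_of_lt hi]
  refine ⟨?_, ?_, ?_, ?_⟩
  · rw [e1, e2, hq, h0]; simp
  · rw [e3, e4, hw, hu]; simp
  · rw [e4, e2, hu, h0]; simp
  · intro a b _ ha hb1 hb2 hrow
    rw [ev a (by omega), ev b (by omega)] at hrow ⊢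
    exact hsep a b (by omega) (by omega) (by omega) hrow

/-- The edges read along an arc of a walk: `{ρ i + p, ρ (i+1) + p}` for `i + 1 < M`, and the closing edge
`{ρ (M−1) + p, ρ 0 + p}`. [cite: Hammond2015SAPJoining, Definition 4.3 p. 20 (arXiv v5)] -/
def arcEdges (ρ : ℕ → Site 2) (p : Site 2) (M : ℕ) : Finset (Sym2 (Site 2)) :=
  insert s(ρ (M - 1) + p, ρ 0 + p) ((Finset.range (M - 1)).image fun i => s(ρ i + p, ρ (i + 1) + p))

/-- **The left half of the joined walk determines the left polygon**: if the `M` edges read along an injective arc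
`ρ 0, …, ρ (M−1)` (translated by `p`) all belong to a polygon `P` with `M` edges, then `P = arcEdges ρ p M`.  (With
`exists_join_loop`: the joined walk determines both capped polygons as positioned edge sets.)
[cite: Hammond2015SAPJoining, §3.2 p. 10 and §4.4 p. 27, (4.9) (arXiv v5: the join polygon and its junction plaquette determine the two halves)] -/
theorem eq_arcEdges {ρ : ℕ → Site 2} (h3 : 3 ≤ M) (hPM : P.card = M)
    (hinj : ∀ i j, i < M → j < M → ρ i = ρ j → i = j)
    (hedges : ∀ i, i + 1 < M → s(ρ i + p, ρ (i + 1) + p) ∈ P)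
    (hclose : s(ρ (M - 1) + p, ρ 0 + p) ∈ P) : P = arcEdges ρ p M := by
  classical
  symm
  apply Finset.eq_of_subset_of_card_le
  · intro e he
    rw [arcEdges, Finset.mem_insert, Finset.mem_image] at he
    rcases he with rfl | ⟨i, hi, rfl⟩
    · exact hclose
    · exact hedges i (by rw [Finset.mem_range] at hi; omega)
  · -- the `M` arc edges are distinct
    have hinj' : Set.InjOn (fun i => s(ρ i + p, ρ (i + 1) + p)) ↑(Finset.range (M - 1)) := by
      intro i hi j hj hij
      rw [Finset.coe_range, Set.mem_Iio] at hi hj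
      simp only [Sym2.eq_iff, add_left_inj] at hij
      rcases hij with ⟨h1, -⟩ | ⟨h1, h2⟩
      · exact hinj i j (by omega) (by omega) h1
      · have a := hinj i (j + 1) (by omega) (by omega) h1
        have b := hinj (i + 1) j (by omega) (by omega) h2
        omega
    have hnot : s(ρ (M - 1) + p, ρ 0 + p) ∉ (Finset.range (M - 1)).image fun i => s(ρ i + p, ρ (i + 1) + p) := by
      intro h
      rw [Finset.mem_image] at h
      obtain ⟨i, hi, hie⟩ := h
      rw [Finset.mem_range] at hi
      simp only [Sym2.eq_iff, add_left_inj] at hie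
      rcases hie with ⟨h1, -⟩ | ⟨h1, h2⟩
      · have := hinj i (M - 1) (by omega) (by omega) h1; omega
      · have := hinj i 0 (by omega) (by omega) h1
        have := hinj (i + 1) (M - 1) (by omega) (by omega) h2
        omega
    rw [hPM, arcEdges, Finset.card_insert_of_notMem hnot, Finset.card_image_of_injOn hinj', Finset.card_range]
    omega

end TriPolygon

end Literature.Probability.RandomPlanarGeometry.SAW
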